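import Summits.QuantumFields.YangMills.Theorems.BalabanUVNodesN20CoreEdgeShellDialDeviationTower

/-!
# BalabanUVNodes ∕ N20 (NE7b) — the `hedge`-JOINT COMPANION, module 13S: A (Dev) FLOOR IN MASS IS LAW SEPARATION — at every class map, a deviation letter that FAILS
# PROPORTIONALLY (`s·Z ≤ Dev`) exhibits a class SET on which the two runs' normalised class laws differ by `≥ s∕2`: the mass currency of modules 13L–13Q and the law
# currency of dag-n19-w4 ∕ dag-n20-w4 ∕ dag-n20-w5 ((LS), `no_dial_rescues`, `lawMerge_of_faces`) meet in ONE implication, at the record for both runs and every key map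

Cell `pub-ymgap` (HUMAN RULING D-0062 Track A; D-0149 width push), seat `pub-ymgap-dag-n20-w3` (WIDTH SEAT 3 of 3 on NODE n20 = NE7b) gen 8, CLAIM-1 ∕ INTENT-1
(pub-ymgap INBOX l.37369).  Filed `--kind proof --supports stmt-QuantumFields-27366 --as helper` (K3⁸ `SpineGivenEndpointR13SepCoPHV`, route rev 28∕29, skeleton v6
b4e55110ab73e679, stub 2 `stub_expansion13HV`; dag-lead KEY MAP v2).  COUNT-NEUTRAL.  ADDITIVE — imports this lineage's module 13P `…N20CoreEdgeShellDialDeviationTower`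
(p624084: `fibreDev_le_two_mul_collapse`; through it dag-n20-d's reading of record `classSet₁₃ ∕ weightA₁₃ ∕ weightB₁₃`, the K edition's `weightAK₁₃ ∕ weightBK₁₃`, node
U5d's `fiberSum`, dag-n20-w2's `weightA₁₃_nonneg ∕ weightB₁₃_nonneg`) ONLY; cone-free; modifies nothing.  [LF-II] = [Balaban1989LargeFieldII], [King1986] = CMP 102 (locations only).

WHY.  Two currencies price the (N19′, N21) pair of K3's stub 2 negatively.  MASS: module 13L's deviation letter `Dev_A(π)(K,t) := Σ_x (weightA₁₃ − (P_{πx}∕Q_{πx})·weightB₁₃)⁺`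
(the intra-class one-sided ℓ¹ deviation of run A from run B rescaled to the class ratio at a class map `π`); module 13N ∕ 13Q showed an UNSUMMABLE floor `d_K·Z < Dev` at ANY
class map kills the pinned ℓ¹ letters ∕ every hybrid binder list `∃ Bad W shA shB Wsh δ, HybridNE7 …` (through dag-n20-w4's summable TV radius p609004 — a road that reads the
binder list's `lt_one`).  LAW: dag-n19-w4's `no_dial_rescues` ∕ `lawMerge_of_faces` (p608854) and dag-n20-w5's `…N20StubTwoFalseOfLawSeparated` (p610536) kill the THREE
FACE-BODIES `RelWeightBound ∧ ShellWeightBound ∧ (Core ∧ Summable δ)` — no `lt_one` — from ONE letter, LAW SEPARATION (LS): cofinally in `K`, some `|t| ≤ 1` and some class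
set `S` with `s ≤ μ_B(S) − μ_A(S)` (CRIT-1 triage ed. 2 item 4: the disprover's one letter).  THIS FILE is the bridge: a PROPORTIONAL (Dev) floor — `s·Z_A ≤ Dev_A(π)`
frequently, at ANY class map `π` — IS an instance of (LS) with constant `s∕2`, by two lines of [folklore] arithmetic:
* §1 (abstract, node U5d's `fiberSum`): `collapseDev_eq_total_mul_classLawGap` — the collapse deviation `Σ_S (p − (Z_p∕Z_q)·q)⁺` IS `Z_p·(μ_p(S⁺) − μ_q(S⁺))` at its
  positive set `S⁺` (module 13P's «collapse deviation = `Z·TV`» with the maximising set NAMED); `classLawGap_sdiff` — complements flip a class-law gap; ★★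
  `exists_classLawGap_ge_of_collapseDev_ge` ∕ ★★ `exists_classLawGap_ge_of_fibreDev_ge` — `s·Z_p ≤ Dev(π)` (any `π`; `p, q ≥ 0`, positive totals) ⇒ `∃ S′ ⊆ S,
  s∕2 ≤ μ_q(S′) − μ_p(S′)` (13P `fibreDev_le_two_mul_collapse`: (Dev) is maximal at the collapse up to the factor 2).
* §2 (the record, any offset `K₀`, any raw per-step key map `π`, both runs): ★★ `exists_classLawGap_ge_of_fibreDevA_record_ge` ∕ `…fibreDevB_record_ge` and the cofinal forms
  ★★★ `lawSeparated_record_of_frequently_fibreDevA_ge` ∕ ★★★ `…fibreDevB_ge` — conclusion = dag-n19-w4's ∕ dag-n20-w5's `hsep` shape VERBATIM (run B minus run A) with `s∕2`.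
LOCATED (said, not decided): the (Dev) currency has TWO negative regimes — (a) proportional floors (`Dev ≥ s·Z` frequently): = (LS), kills the faces dial-free (this file +
p608854 ∕ p610536, and at K3⁸'s texts the companion module 13T); (b) vanishing-but-unsummable floors (`Dev_K = o(Z_K)`, `Σ Dev_K∕Z_K = ∞`): laws MERGE, `no_dial_rescues` is silent,
and the kill is 13N ∕ 13Q's (summable-radius) road — the regime where dag-n20-w1's «slowly merging» caricatures live.  Nothing here decides which regime, if any, the record is in.

HONEST FRAMING.  [folklore] finite-sum ∕ `max` arithmetic over the tree's SHAPES; proves NO estimate of the programme; every floor ∕ letter is a HYPOTHESIS on Bałaban's two-run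
class weights, measured by nobody; nothing of Bałaban's asserted; no `Provisos₁₃CoPH` inhabitant claimed (K0⁷ OPEN); NE7 ∕ NE7b ∕ NE7c NOT PRINTED for `d = 4` ∕ NOT PROVED;
N19 ∕ N20 ∕ N21 NOT discharged; `stub_expansion13HV` NOT closed and NOT refuted; K3⁸ ∕ K3⁷ OPEN, v6 ∕ v5 STAND, not claimed; counts unmoved; no count claim.  One finite
`𝕋⁴_{L^K}` programme at fixed `ε = L^{−K}`, Bałaban AS PRINTED; the YM mass gap (Clay) is NOT proved by any of this — R4 closes the conditional finite-𝕋⁴ rung `BalabanLadder.UV`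
only; NOT ℝ⁴, NOT continuum, NOT OS.  No `def`, no `instance`, no `notation`, no `sorry`, no private decls.  Sources (location only): [LF-II] Thm 1 + (0.1) pp.355–356, (1.80)
p.384; [King1986] (3.10)–(3.13) pp.656–657 (the hybrid template).
-/

noncomputable section

open Finset
open scoped BigOperators

namespace Summit.QuantumFields.YangMills.BalabanUVNodes.N20CoreEdgeShellDialDeviationSeparation

open Literature.MathematicalPhysics.QuantumFieldTheory.Balaban1983to89
open Literature.MathematicalPhysics.QuantumFieldTheory.Balaban1983to89.T4Continuum
open Literature.MathematicalPhysics.QuantumFieldTheory.Balaban1983to89.Node00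
open T4HybridMatching (fiberSum)
open Summit.QuantumFields.BalabanUV.T4Continuum.Spine YMDAG.UVSplit
open Summit.QuantumFields.YangMills.BalabanUVNodes.N21KeyedShellWeightShellZero (weightA₁₃_nonneg weightB₁₃_nonneg)
open Summit.QuantumFields.YangMills.BalabanUVNodes.N20CoreEdgeShellDialDeviationTower (fibreDev_le_two_mul_collapse)

/-! ## §1 Abstract: the collapse deviation is a class-law gap at its positive set; a proportional (Dev) floor at any class map exhibits a separated class set -/

section MassToLaw

variable {σ ι : Type*} [DecidableEq σ] [DecidableEq ι]

omit [DecidableEq σ] in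
/-- **THE COLLAPSE DEVIATION IS `Z_p` TIMES THE CLASS-LAW GAP AT ITS POSITIVE SET** [folklore]: with `m := Z_p∕Z_q` and `S⁺ := {x ∈ S | 0 ≤ p x − m·q x}`,
`Σ_S (p − m·q)⁺ = Z_p·(μ_p(S⁺) − μ_q(S⁺))` (`Z_p, Z_q ≠ 0`; module 13P's `collapseDev_le_of_classLawTV` inequality is this identity plus `|·| ≤ r` at `S⁺`). -/
theorem collapseDev_eq_total_mul_classLawGap (S : Finset σ) (p q : σ → ℝ) (hZp : ∑ x ∈ S, p x ≠ 0) (hZq : ∑ x ∈ S, q x ≠ 0) :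
    ∑ x ∈ S, max 0 (p x - (∑ x ∈ S, p x) / (∑ x ∈ S, q x) * q x) =
      (∑ x ∈ S, p x) *
        ((∑ x ∈ S.filter (fun x => 0 ≤ p x - (∑ x ∈ S, p x) / (∑ x ∈ S, q x) * q x), p x) / (∑ x ∈ S, p x) -
          (∑ x ∈ S.filter (fun x => 0 ≤ p x - (∑ x ∈ S, p x) / (∑ x ∈ S, q x) * q x), q x) / (∑ x ∈ S, q x)) := by
  set m : ℝ := (∑ x ∈ S, p x) / (∑ x ∈ S, q x) with hm
  have hpos : ∑ x ∈ S, max 0 (p x - m * q x) = ∑ x ∈ S.filter (fun x => 0 ≤ p x - m * q x), (p x - m * q x) := by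
    rw [Finset.sum_filter]
    exact Finset.sum_congr rfl fun x _ => by
      split_ifs with h
      · exact max_eq_right h
      · exact max_eq_left (le_of_lt (not_le.mp h))
  rw [hpos, Finset.sum_sub_distrib, ← Finset.mul_sum]
  set A : ℝ := ∑ x ∈ S.filter (fun x => 0 ≤ p x - m * q x), p x
  set B : ℝ := ∑ x ∈ S.filter (fun x => 0 ≤ p x - m * q x), q x
  rw [hm]
  field_simp

/-- **COMPLEMENTS FLIP A CLASS-LAW GAP** [folklore]: for `S′ ⊆ S`, `μ_q(S ∖ S′) − μ_p(S ∖ S′) = μ_p(S′) − μ_q(S′)` (both laws have total mass `1`; `Z_p, Z_q ≠ 0`). -/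
theorem classLawGap_sdiff (S : Finset σ) (p q : σ → ℝ) {S' : Finset σ} (hS' : S' ⊆ S) (hZp : ∑ x ∈ S, p x ≠ 0) (hZq : ∑ x ∈ S, q x ≠ 0) :
    (∑ x ∈ S \ S', q x) / (∑ x ∈ S, q x) - (∑ x ∈ S \ S', p x) / (∑ x ∈ S, p x) =
      (∑ x ∈ S', p x) / (∑ x ∈ S, p x) - (∑ x ∈ S', q x) / (∑ x ∈ S, q x) := by
  have hp : ∑ x ∈ S \ S', p x = ∑ x ∈ S, p x - ∑ x ∈ S', p x := eq_sub_of_add_eq (Finset.sum_sdiff hS')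
  have hq : ∑ x ∈ S \ S', q x = ∑ x ∈ S, q x - ∑ x ∈ S', q x := eq_sub_of_add_eq (Finset.sum_sdiff hS')
  rw [hp, hq, sub_div, sub_div, div_self hZp, div_self hZq]
  ring

/-- **★★ A PROPORTIONAL COLLAPSE-DEVIATION FLOOR EXHIBITS A SEPARATED CLASS SET** [folklore]: positive totals and `s·Z_p ≤ Σ_S (p − (Z_p∕Z_q)·q)⁺` give a class set
`S′ ⊆ S` (the complement of the positive set) with `s ≤ μ_q(S′) − μ_p(S′)` — the `hsep` orientation of dag-n19-w4's `LawSeparated` when `(p, q) = (run A, run B)`. -/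
theorem exists_classLawGap_ge_of_collapseDev_ge (S : Finset σ) (p q : σ → ℝ) {s : ℝ} (hZp : 0 < ∑ x ∈ S, p x) (hZq : 0 < ∑ x ∈ S, q x)
    (h : s * ∑ x ∈ S, p x ≤ ∑ x ∈ S, max 0 (p x - (∑ x ∈ S, p x) / (∑ x ∈ S, q x) * q x)) :
    ∃ S' ⊆ S, s ≤ (∑ x ∈ S', q x) / (∑ x ∈ S, q x) - (∑ x ∈ S', p x) / (∑ x ∈ S, p x) := by
  refine ⟨S \ S.filter (fun x => 0 ≤ p x - (∑ x ∈ S, p x) / (∑ x ∈ S, q x) * q x), Finset.sdiff_subset, ?_⟩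
  rw [classLawGap_sdiff S p q (Finset.filter_subset _ S) hZp.ne' hZq.ne']
  rw [collapseDev_eq_total_mul_classLawGap S p q hZp.ne' hZq.ne', mul_comm] at h
  exact le_of_mul_le_mul_left h hZp

/-- **★★ A PROPORTIONAL (Dev) FLOOR AT ANY CLASS MAP EXHIBITS A SEPARATED CLASS SET** [folklore]: `p, q ≥ 0`, positive totals, and `s·Z_p ≤ Dev(π) :=
Σ_S (p − (P_{πx}∕Q_{πx})·q)⁺` for a class map `π` (fibre sums `P = fiberSum S π p`, `Q = fiberSum S π q`) ⇒ `∃ S′ ⊆ S, s∕2 ≤ μ_q(S′) − μ_p(S′)` — module 13P's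
`fibreDev_le_two_mul_collapse` ((Dev) is maximal at the collapse up to the factor `2`) then the collapse case. -/
theorem exists_classLawGap_ge_of_fibreDev_ge (S : Finset σ) (π : σ → ι) (p q : σ → ℝ) {s : ℝ} (hp : ∀ x ∈ S, 0 ≤ p x) (hq : ∀ x ∈ S, 0 ≤ q x)
    (hZp : 0 < ∑ x ∈ S, p x) (hZq : 0 < ∑ x ∈ S, q x)
    (h : s * ∑ x ∈ S, p x ≤ ∑ x ∈ S, max 0 (p x - fiberSum S π p (π x) / fiberSum S π q (π x) * q x)) :
    ∃ S' ⊆ S, s / 2 ≤ (∑ x ∈ S', q x) / (∑ x ∈ S, q x) - (∑ x ∈ S', p x) / (∑ x ∈ S, p x) := by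
  refine exists_classLawGap_ge_of_collapseDev_ge S p q hZp hZq ?_
  have h2 := fibreDev_le_two_mul_collapse S π p q hp hq
  linarith

/-- **… IN THE OTHER ORIENTATION** [folklore]: the same floor also exhibits `S″ ⊆ S` (the positive set itself) with `s∕2 ≤ μ_p(S″) − μ_q(S″)`. -/
theorem exists_classLawGap_ge_of_fibreDev_ge' (S : Finset σ) (π : σ → ι) (p q : σ → ℝ) {s : ℝ} (hp : ∀ x ∈ S, 0 ≤ p x) (hq : ∀ x ∈ S, 0 ≤ q x)
    (hZp : 0 < ∑ x ∈ S, p x) (hZq : 0 < ∑ x ∈ S, q x)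
    (h : s * ∑ x ∈ S, p x ≤ ∑ x ∈ S, max 0 (p x - fiberSum S π p (π x) / fiberSum S π q (π x) * q x)) :
    ∃ S'' ⊆ S, s / 2 ≤ (∑ x ∈ S'', p x) / (∑ x ∈ S, p x) - (∑ x ∈ S'', q x) / (∑ x ∈ S, q x) := by
  obtain ⟨S', hS', hgap⟩ := exists_classLawGap_ge_of_fibreDev_ge S π p q hp hq hZp hZq h
  refine ⟨S \ S', Finset.sdiff_subset, ?_⟩
  rw [classLawGap_sdiff S q p hS' hZq.ne' hZp.ne']
  exact hgap

end MassToLaw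

/-! ## §2 At the record (any offset `K₀`, any raw per-step key map, both runs): module 13L's deviation letters failing proportionally ⇒ dag-n19-w4's `hsep` with `s∕2` -/

section Record

variable {F : T4Family} {N : ℕ} [NeZero N] (K₀ : ℕ) (θ : Stage13HParams F N) (hP : θ.Provisos₁₃CoPH F N) (g₀ : ℕ → ℝ) (os : List (ULoop F))
  (π : ℕ → (Σ K, SiteSeqKey F (K₀ + K)) → (Σ K, SiteSeqKey F (K₀ + K)))

/-- **★★ AT THE RECORD, run A** [bookkeeping]: at `(K, t)` with positive totals, if module 13L's run-A deviation at the key map `π` (coarse weights `weightAK₁₃ ∕ weightBK₁₃` = the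
`π`-fibre sums) is at least `s·Σ weightA₁₃`, then some class set `S ⊆ classSet₁₃ θ K₀ g₀ K` has `s∕2 ≤ μ_B(S) − μ_A(S)` (dag-n19-w4's `hsep` inner shape). The floor is a HYPOTHESIS.
[cite: Balaban1989LargeFieldII, Thm 1 + (0.1) pp.355–356 (location only)] -/
theorem exists_classLawGap_ge_of_fibreDevA_record_ge {s : ℝ} {K : ℕ} {t : ℝ}
    (hZA : 0 < ∑ x ∈ classSet₁₃ θ K₀ g₀ K, weightA₁₃ θ hP K₀ g₀ os K t x) (hZB : 0 < ∑ x ∈ classSet₁₃ θ K₀ g₀ K, weightB₁₃ θ hP K₀ g₀ os K t x)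
    (h : s * ∑ x ∈ classSet₁₃ θ K₀ g₀ K, weightA₁₃ θ hP K₀ g₀ os K t x ≤
      ∑ x ∈ classSet₁₃ θ K₀ g₀ K, max 0 (weightA₁₃ θ hP K₀ g₀ os K t x -
        weightAK₁₃ θ hP K₀ g₀ os π K t (π K x) / weightBK₁₃ θ hP K₀ g₀ os π K t (π K x) * weightB₁₃ θ hP K₀ g₀ os K t x)) :
    ∃ S ⊆ classSet₁₃ θ K₀ g₀ K,
      s / 2 ≤ (∑ x ∈ S, weightB₁₃ θ hP K₀ g₀ os K t x) / (∑ x ∈ classSet₁₃ θ K₀ g₀ K, weightB₁₃ θ hP K₀ g₀ os K t x) -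
        (∑ x ∈ S, weightA₁₃ θ hP K₀ g₀ os K t x) / (∑ x ∈ classSet₁₃ θ K₀ g₀ K, weightA₁₃ θ hP K₀ g₀ os K t x) := by
  letI : ∀ Kc, DecidableEq (SiteSeqKey F Kc) := fun _ => Classical.decEq _
  exact exists_classLawGap_ge_of_fibreDev_ge (classSet₁₃ θ K₀ g₀ K) (π K) (weightA₁₃ θ hP K₀ g₀ os K t) (weightB₁₃ θ hP K₀ g₀ os K t)
    (fun x _ => weightA₁₃_nonneg F θ hP K₀ g₀ os K t x) (fun x _ => weightB₁₃_nonneg F θ hP K₀ g₀ os K t x) hZA hZB h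

/-- **★★ AT THE RECORD, run B** [bookkeeping]: the run-B deviation at `π` at least `s·Σ weightB₁₃` ⇒ some `S ⊆ classSet₁₃` with `s∕2 ≤ μ_B(S) − μ_A(S)` (same orientation:
the positive set of run B's collapse deviation itself, `exists_classLawGap_ge_of_fibreDev_ge'`). [cite: Balaban1989LargeFieldII, (1.80) p.384 (location only)] -/
theorem exists_classLawGap_ge_of_fibreDevB_record_ge {s : ℝ} {K : ℕ} {t : ℝ}
    (hZA : 0 < ∑ x ∈ classSet₁₃ θ K₀ g₀ K, weightA₁₃ θ hP K₀ g₀ os K t x) (hZB : 0 < ∑ x ∈ classSet₁₃ θ K₀ g₀ K, weightB₁₃ θ hP K₀ g₀ os K t x)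
    (h : s * ∑ x ∈ classSet₁₃ θ K₀ g₀ K, weightB₁₃ θ hP K₀ g₀ os K t x ≤
      ∑ x ∈ classSet₁₃ θ K₀ g₀ K, max 0 (weightB₁₃ θ hP K₀ g₀ os K t x -
        weightBK₁₃ θ hP K₀ g₀ os π K t (π K x) / weightAK₁₃ θ hP K₀ g₀ os π K t (π K x) * weightA₁₃ θ hP K₀ g₀ os K t x)) :
    ∃ S ⊆ classSet₁₃ θ K₀ g₀ K,
      s / 2 ≤ (∑ x ∈ S, weightB₁₃ θ hP K₀ g₀ os K t x) / (∑ x ∈ classSet₁₃ θ K₀ g₀ K, weightB₁₃ θ hP K₀ g₀ os K t x) -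
        (∑ x ∈ S, weightA₁₃ θ hP K₀ g₀ os K t x) / (∑ x ∈ classSet₁₃ θ K₀ g₀ K, weightA₁₃ θ hP K₀ g₀ os K t x) := by
  letI : ∀ Kc, DecidableEq (SiteSeqKey F Kc) := fun _ => Classical.decEq _
  exact exists_classLawGap_ge_of_fibreDev_ge' (classSet₁₃ θ K₀ g₀ K) (π K) (weightB₁₃ θ hP K₀ g₀ os K t) (weightA₁₃ θ hP K₀ g₀ os K t)
    (fun x _ => weightB₁₃_nonneg F θ hP K₀ g₀ os K t x) (fun x _ => weightA₁₃_nonneg F θ hP K₀ g₀ os K t x) hZB hZA h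

/-- **★★★ A PROPORTIONAL run-A (Dev) FLOOR, FREQUENTLY IN `K`, IS LAW SEPARATION** [bookkeeping]: if for every `K₁` there are `K ≥ K₁` and `|t| ≤ 1` with positive totals and
`s·Σ weightA₁₃ ≤ Dev_A(π)(K, t)`, then the record's two across-class laws are `s∕2`-SEPARATED cofinally — dag-n19-w4's `hsep` ∕ dag-n20-w5's (LS) hypothesis VERBATIM, the
letter under which `no_dial_rescues` ∕ `lawMerge_of_faces` refute the three faces of stub 2 at every dial.  The floor is a HYPOTHESIS — NOT PRINTED, NOT measured.
[cite: King1986, (3.10)–(3.13) pp.656–657 (template only)] -/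
theorem lawSeparated_record_of_frequently_fibreDevA_ge {s : ℝ}
    (h : ∀ K₁ : ℕ, ∃ K, K₁ ≤ K ∧ ∃ t : ℝ, |t| ≤ 1 ∧
      0 < ∑ x ∈ classSet₁₃ θ K₀ g₀ K, weightA₁₃ θ hP K₀ g₀ os K t x ∧ 0 < ∑ x ∈ classSet₁₃ θ K₀ g₀ K, weightB₁₃ θ hP K₀ g₀ os K t x ∧
      s * ∑ x ∈ classSet₁₃ θ K₀ g₀ K, weightA₁₃ θ hP K₀ g₀ os K t x ≤
        ∑ x ∈ classSet₁₃ θ K₀ g₀ K, max 0 (weightA₁₃ θ hP K₀ g₀ os K t x -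
          weightAK₁₃ θ hP K₀ g₀ os π K t (π K x) / weightBK₁₃ θ hP K₀ g₀ os π K t (π K x) * weightB₁₃ θ hP K₀ g₀ os K t x)) :
    ∀ K₁ : ℕ, ∃ K, K₁ ≤ K ∧ ∃ t : ℝ, |t| ≤ 1 ∧ ∃ S, S ⊆ classSet₁₃ θ K₀ g₀ K ∧
      s / 2 ≤ (∑ x ∈ S, weightB₁₃ θ hP K₀ g₀ os K t x) / (∑ x ∈ classSet₁₃ θ K₀ g₀ K, weightB₁₃ θ hP K₀ g₀ os K t x) -
        (∑ x ∈ S, weightA₁₃ θ hP K₀ g₀ os K t x) / (∑ x ∈ classSet₁₃ θ K₀ g₀ K, weightA₁₃ θ hP K₀ g₀ os K t x) := by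
  intro K₁
  obtain ⟨K, hK, t, ht, hZA, hZB, hfloor⟩ := h K₁
  obtain ⟨S, hS, hgap⟩ := exists_classLawGap_ge_of_fibreDevA_record_ge K₀ θ hP g₀ os π hZA hZB hfloor
  exact ⟨K, hK, t, ht, S, hS, hgap⟩

/-- **★★★ … AND SO IS A PROPORTIONAL run-B (Dev) FLOOR** [bookkeeping] (same conclusion, same orientation). [cite: King1986, (3.10)–(3.13) pp.656–657 (template only)] -/
theorem lawSeparated_record_of_frequently_fibreDevB_ge {s : ℝ}
    (h : ∀ K₁ : ℕ, ∃ K, K₁ ≤ K ∧ ∃ t : ℝ, |t| ≤ 1 ∧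
      0 < ∑ x ∈ classSet₁₃ θ K₀ g₀ K, weightA₁₃ θ hP K₀ g₀ os K t x ∧ 0 < ∑ x ∈ classSet₁₃ θ K₀ g₀ K, weightB₁₃ θ hP K₀ g₀ os K t x ∧
      s * ∑ x ∈ classSet₁₃ θ K₀ g₀ K, weightB₁₃ θ hP K₀ g₀ os K t x ≤
        ∑ x ∈ classSet₁₃ θ K₀ g₀ K, max 0 (weightB₁₃ θ hP K₀ g₀ os K t x -
          weightBK₁₃ θ hP K₀ g₀ os π K t (π K x) / weightAK₁₃ θ hP K₀ g₀ os π K t (π K x) * weightA₁₃ θ hP K₀ g₀ os K t x)) :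
    ∀ K₁ : ℕ, ∃ K, K₁ ≤ K ∧ ∃ t : ℝ, |t| ≤ 1 ∧ ∃ S, S ⊆ classSet₁₃ θ K₀ g₀ K ∧
      s / 2 ≤ (∑ x ∈ S, weightB₁₃ θ hP K₀ g₀ os K t x) / (∑ x ∈ classSet₁₃ θ K₀ g₀ K, weightB₁₃ θ hP K₀ g₀ os K t x) -
        (∑ x ∈ S, weightA₁₃ θ hP K₀ g₀ os K t x) / (∑ x ∈ classSet₁₃ θ K₀ g₀ K, weightA₁₃ θ hP K₀ g₀ os K t x) := by
  intro K₁
  obtain ⟨K, hK, t, ht, hZA, hZB, hfloor⟩ := h K₁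
  obtain ⟨S, hS, hgap⟩ := exists_classLawGap_ge_of_fibreDevB_record_ge K₀ θ hP g₀ os π hZA hZB hfloor
  exact ⟨K, hK, t, ht, S, hS, hgap⟩

end Record

end Summit.QuantumFields.YangMills.BalabanUVNodes.N20CoreEdgeShellDialDeviationSeparation

end
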